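import Literature.Analysis.FluidPDE.StatisticalSolutions
import Literature.Analysis.FluidPDE.SteadyNavierStokes
import Literature.Analysis.FluidPDE.SteadyNavierStokesEnergy
import Literature.Analysis.FluidPDE.SteadyNavierStokesProofs
import HarnessLib

/-!
# Existence of stationary statistical solutions on `T³` (discharge of `fmrt_existence`)

This file **discharges** the named fact `Literature.Analysis.FluidPDE.fmrt_existence`
(`Literature.Analysis.FluidPDE.StatisticalSolutions`, item `turb.S07`; Foias–Manley–Rosa–Temam
2001, Ch. IV, Thm. 3.1 with Thm. 4.2): for every viscosity `ν > 0` and every force `f ∈ H` there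
is a stationary statistical solution `μ` of the space-periodic Navier–Stokes equations on `T³`
(the accepted `Torus.IsStationaryStatisticalSolution ν f μ`: a Borel probability measure on `H`
with finite mean enstrophy, satisfying the stationary Liouville / Foias–Prodi identity on
cylindrical test functionals and the energy inequality on energy shells, FMRT Ch. IV §1.2,
Def. 1.3, (1.29)–(1.31)).

## The printed argument and the route taken here

In print (FMRT 2001, Ch. IV §3–§4) existence is obtained from a Leray–Hopf solution `u` with
datum in `H`: its time averages along a generalized (Banach) limit define a time-average measure
(Thm. 4.2), and every time-average measure is a stationary statistical solution (Thm. 3.1).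

The book also records (Ch. IV §1.2, the remark following Def. 1.3, pp. 181–182 of the printed
book) that the Dirac measure `δ_{u}` carried by a *stationary* (steady weak) solution `u ∈ V` of
the forced equations is a stationary statistical solution; together with the existence of a
steady weak solution for **every** viscosity and every `f ∈ L²` (Temam 1979, Ch. II §1,
Thm. 1.2 — no smallness is needed for existence, only for uniqueness) this gives the existence
statement directly. Both ingredients are theorems of the tree:

* `Torus.Temam1979_exists_steadyWeakSolution_holds` (`SteadyNavierStokesProofs`: Fourier–Galerkin
  approximations by the Brouwer acute-angle lemma, the a priori enstrophy bound, Rellich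
  compactness in `H`, passage to the limit against band-limited and then all smooth
  divergence-free test fields), giving `u ∈ V` with `Torus.IsSteadyWeakSolution ν f u`;
* `Torus.isStationaryStatisticalSolution_dirac_holds` (`SteadyNavierStokesEnergy`: the energy
  equation `ν ‖∇u‖² = (f, u)` of steady weak solutions for `d ≤ 4`, fed into
  `Torus.IsSteadyWeakSolution.isStationaryStatisticalSolution_dirac` of
  `StatisticalSolutionDirac`, which verifies (1.29)–(1.31) for `δ_u`);

and `Torus.exists_isStationaryStatisticalSolution` (`SteadyNavierStokes`) is the two-line
combination `μ := δ_u`. The present file specialises it to `d = Fin 3` (`card = 3 ≤ 4`) and to a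
force `f : H`, which enters the accepted predicate through its `Lp` representative (in `L²` by
`MeasureTheory.Lp.memLp`), exactly as in the statement of `fmrt_existence`.

The time-average line of the book is formalised separately (`exists_timeAverageMeasure`,
`timeAverage_isStationary_holds` in `StatisticalSolutionsProofs`); it is not needed for the bare
existence statement.

Main result: `fmrt_existence_holds`.

## References

* C. Foias, O. Manley, R. Rosa, R. Temam, *Navier–Stokes Equations and Turbulence*, Encyclopedia
  of Mathematics and its Applications 83, CUP (2001), Ch. IV §1.2 Def. 1.3 and the remark
  following it (Dirac measures at stationary solutions), §3.1 Thm. 3.1, §4 Thm. 4.2. [FMRT2001]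
* R. Temam, *Navier–Stokes Equations: Theory and Numerical Analysis*, North-Holland (1977;
  rev. ed. 1979), Ch. II §1, Thm. 1.2. [Temam1979]
* C. Foias, Statistical study of Navier–Stokes equations I, *Rend. Sem. Mat. Univ. Padova* 48
  (1972), 219–348, §3.
-/

noncomputable section

open MeasureTheory

namespace Literature.Analysis.FluidPDE

/-- **Discharge of the named fact `fmrt_existence`** (turb.S07; Foias–Manley–Rosa–Temam 2001,
Ch. IV Thm. 3.1 with Thm. 4.2: for every `ν > 0` and `f ∈ H` the space-periodic Navier–Stokes
equations on `T³` have a stationary statistical solution). The witness is the Dirac measure at a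
steady weak solution `u ∈ V` (Temam 1979, Ch. II Thm. 1.2, every viscosity;
`Torus.Temam1979_exists_steadyWeakSolution_holds`), which is a stationary statistical solution
by FMRT 2001, Ch. IV §1.2, remark after Def. 1.3 (`Torus.isStationaryStatisticalSolution_dirac_holds`),
combined in `Torus.exists_isStationaryStatisticalSolution` at `d = Fin 3`.
[cite: FMRT2001, Ch. IV Thm. 3.1 (with Thm. 4.2); Ch. IV §1.2, remark after Def. 1.3] -/
theorem fmrt_existence_holds : fmrt_existence := fun _ν hν f =>
  Torus.exists_isStationaryStatisticalSolution Torus.Temam1979_exists_steadyWeakSolution_holds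
    Torus.isStationaryStatisticalSolution_dirac_holds (by simp) hν (Lp.memLp _)

end Literature.Analysis.FluidPDE
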